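import Literature.NumberTheory.Automorphic.Shelstad1979.StableOrbitalIntegrals   -- ★ `HasOneSidedJump` (the carpet of Shelstad's §4 jump statements)
import Literature.Analysis.Calculus.IteratedFDerivLeibniz                          -- (LEIBNIZ-JET) (a): `iteratedFDeriv_mul_apply_eq_sum_powerset`
import Mathlib.Analysis.Calculus.ContDiff.RCLike
import HarnessLib

/-!
# One-sided jumps of the jets of a product `u · h` along a transversal ray, `u` smooth (Leibniz for jumps)
# (Shelstad 1979 §4 pp. 22–26; Bouaziz 1994 §3.2 (I₃) p. 580)

Topic `NumberTheory/Automorphic/Shelstad1979`; namespace `Literature.NumberTheory.Automorphic.Shelstad1979.StableOrbitalIntegrals` (home of ★ `HasOneSidedJump`).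
THEOREMS ONLY (no `def`, no instance, no notation, no axiom, no named fact, no `sorry`).  Cell `pub/hodgecm-mathlib`, line LH3 (crux H413 = `stmt-HodgeConjecture-24833`,
closer stub `stub_N9`, organ O-L2 `stub_N9transf`), brick (LEIBNIZ-JET) (b) for LH7-p02 (g2)'s (I₃-TRANSF) ED. 3 (all orders); seat F0P3a-p09 (g5).

`hasOneSidedJump_iteratedFDeriv_mul_ray`: `u` `C^∞` on an open `U ∋ x`, `h` `C^∞` on an open `O` containing the punctured ray `x + t•v` (`t ≠ 0` small), and for every subset
`s ⊆ Fin n` the jet `t ↦ D^{|s|}h(x + t v)(m ∘ s↑)` has one-sided limits `Lp s` (`t → 0⁺`) and `Lm s` (`t → 0⁻`).  Then `t ↦ Dⁿ(u·h)(x + t v)(m)` has the one-sided jump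
`Σ_s D^{|s|}u(x)(m ∘ s↑) · (Lp sᶜ − Lm sᶜ)` — Leibniz on words ((a)) off `t = 0`, continuity of the jets of `u` at `x`, limits of sums and products.  At order `0` this is
★ `hasOneSidedJump_mul_of_tendsto` (LH7-p02's kit); here all orders, every word.  Also the two one-sided limits themselves (`tendsto_iteratedFDeriv_mul_ray_nhdsGT∕LT`).
HONEST LABEL: HC_CM is proved only modulo the 7 printed citations (2 remaining named inputs: hLiu418 = `stmt-HodgeConjecture-24832`, h413 = `stmt-HodgeConjecture-24833`) until rung 0
closes; count-neutral calculus under O-L2, pays no organ.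

## References
* [Shelstad1979] D. Shelstad, *Characters and inner forms of a quasi-split group over ℝ*, Compositio Math. 39 (1979) 11–45, §4 pp. 22–26 (jumps of `F_f` and of its
  derivatives `D F_f` across a wall, property (II), Lemma 4.3, Prop. 4.5).
* [Bouaziz1994IntegralesOrbitales] A. Bouaziz, *Intégrales orbitales sur les algèbres de Lie réductives*, Invent. Math. 115 (1994), §3.2 (I₃) p. 580.
* [HormanderALPDO1] L. Hörmander, *The Analysis of Linear Partial Differential Operators I*, Springer (1983), §1.1 (1.1.9) p. 12.
-/

open Set Filter Topology Finset Function
open scoped ContDiff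
open Literature.Analysis.Calculus

namespace Literature.NumberTheory.Automorphic.Shelstad1979.StableOrbitalIntegrals

variable {E : Type*} [NormedAddCommGroup E] [NormedSpace ℝ E]

/-- The ray `t ↦ x + t • v` tends to `x` as `t → 0`. [cite: Shelstad1979, §4 p. 22] -/
theorem tendsto_ray_nhds_zero (x v : E) : Tendsto (fun t : ℝ => x + t • v) (𝓝 0) (𝓝 x) := by
  have h : Continuous fun t : ℝ => x + t • v := by fun_prop
  simpa using h.tendsto 0

/-- The jets of a function `C^∞` on an open `U ∋ x`, read on a fixed word, are continuous along the ray through `x`. [cite: Bouaziz1994IntegralesOrbitales, §3.2 (I₁) p. 579] -/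
theorem tendsto_iteratedFDeriv_apply_ray {U : Set E} (hU : IsOpen U) {x : E} (hx : x ∈ U) {u : E → ℂ} (hu : ContDiffOn ℝ ∞ u U)
    (v : E) (k : ℕ) (w : Fin k → E) :
    Tendsto (fun t : ℝ => iteratedFDeriv ℝ k u (x + t • v) w) (𝓝 0) (𝓝 (iteratedFDeriv ℝ k u x w)) := by
  have h1 : ContinuousAt (iteratedFDeriv ℝ k u) x := (hu.contDiffAt (hU.mem_nhds hx)).continuousAt_iteratedFDeriv (by exact_mod_cast le_top)
  exact ((ContinuousMultilinearMap.apply ℝ (fun _ : Fin k => E) ℂ w).continuous.tendsto _).comp (h1.tendsto.comp (tendsto_ray_nhds_zero x v))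

/-- **LEIBNIZ ALONG THE PUNCTURED RAY**: off `t = 0` near `0`, the jet of `u · h` on the word `m` is the subset sum of products of jets.
[cite: HormanderALPDO1, §1.1 (1.1.9) p. 12] [cite: Bouaziz1994IntegralesOrbitales, §3.2 (I₃) p. 580] -/
theorem eventually_iteratedFDeriv_mul_ray_eq_sum {U O : Set E} (hU : IsOpen U) (hO : IsOpen O) {x v : E} (hx : x ∈ U) {u h : E → ℂ}
    (hu : ContDiffOn ℝ ∞ u U) (hh : ContDiffOn ℝ ∞ h O) (hray : ∀ᶠ t : ℝ in 𝓝[≠] 0, x + t • v ∈ O) {n : ℕ} (m : Fin n → E) :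
    ∀ᶠ t : ℝ in 𝓝[≠] 0, iteratedFDeriv ℝ n (fun y => u y * h y) (x + t • v) m =
      ∑ s : Finset (Fin n), iteratedFDeriv ℝ s.card u (x + t • v) (m ∘ ⇑(s.orderEmbOfFin rfl)) *
        iteratedFDeriv ℝ sᶜ.card h (x + t • v) (m ∘ ⇑(sᶜ.orderEmbOfFin rfl)) := by
  have hU' : ∀ᶠ t : ℝ in 𝓝[≠] 0, x + t • v ∈ U := nhdsWithin_le_nhds (tendsto_ray_nhds_zero x v (hU.mem_nhds hx))
  filter_upwards [hU', hray] with t htU htO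
  exact iteratedFDeriv_mul_apply_eq_sum_powerset (hU.inter hO) n ((hu.of_le (by exact_mod_cast le_top)).mono inter_subset_left)
    ((hh.of_le (by exact_mod_cast le_top)).mono inter_subset_right) ⟨htU, htO⟩ m

/-- **THE RIGHT LIMIT of the jets of `u · h` along the ray.** [cite: Shelstad1979, §4 Lemma 4.3 p. 25] [cite: Bouaziz1994IntegralesOrbitales, §3.2 (I₃) p. 580] -/
theorem tendsto_iteratedFDeriv_mul_ray_nhdsGT {U O : Set E} (hU : IsOpen U) (hO : IsOpen O) {x v : E} (hx : x ∈ U) {u h : E → ℂ}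
    (hu : ContDiffOn ℝ ∞ u U) (hh : ContDiffOn ℝ ∞ h O) (hray : ∀ᶠ t : ℝ in 𝓝[≠] 0, x + t • v ∈ O) {n : ℕ} (m : Fin n → E)
    {Lp : Finset (Fin n) → ℂ}
    (hlim : ∀ s : Finset (Fin n), Tendsto (fun t : ℝ => iteratedFDeriv ℝ s.card h (x + t • v) (m ∘ ⇑(s.orderEmbOfFin rfl))) (𝓝[>] 0) (𝓝 (Lp s))) :
    Tendsto (fun t : ℝ => iteratedFDeriv ℝ n (fun y => u y * h y) (x + t • v) m) (𝓝[>] 0)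
      (𝓝 (∑ s : Finset (Fin n), iteratedFDeriv ℝ s.card u x (m ∘ ⇑(s.orderEmbOfFin rfl)) * Lp sᶜ)) := by
  refine Tendsto.congr' ((eventually_iteratedFDeriv_mul_ray_eq_sum hU hO hx hu hh hray m).filter_mono (nhdsGT_le_nhdsNE 0)
    |>.mono fun t ht => ht.symm) ?_
  exact tendsto_finsetSum _ fun s _ =>
    ((tendsto_iteratedFDeriv_apply_ray hU hx hu v s.card _).mono_left nhdsWithin_le_nhds).mul (hlim sᶜ)

/-- **THE LEFT LIMIT of the jets of `u · h` along the ray.** [cite: Shelstad1979, §4 Lemma 4.3 p. 25] [cite: Bouaziz1994IntegralesOrbitales, §3.2 (I₃) p. 580] -/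
theorem tendsto_iteratedFDeriv_mul_ray_nhdsLT {U O : Set E} (hU : IsOpen U) (hO : IsOpen O) {x v : E} (hx : x ∈ U) {u h : E → ℂ}
    (hu : ContDiffOn ℝ ∞ u U) (hh : ContDiffOn ℝ ∞ h O) (hray : ∀ᶠ t : ℝ in 𝓝[≠] 0, x + t • v ∈ O) {n : ℕ} (m : Fin n → E)
    {Lm : Finset (Fin n) → ℂ}
    (hlim : ∀ s : Finset (Fin n), Tendsto (fun t : ℝ => iteratedFDeriv ℝ s.card h (x + t • v) (m ∘ ⇑(s.orderEmbOfFin rfl))) (𝓝[<] 0) (𝓝 (Lm s))) :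
    Tendsto (fun t : ℝ => iteratedFDeriv ℝ n (fun y => u y * h y) (x + t • v) m) (𝓝[<] 0)
      (𝓝 (∑ s : Finset (Fin n), iteratedFDeriv ℝ s.card u x (m ∘ ⇑(s.orderEmbOfFin rfl)) * Lm sᶜ)) := by
  refine Tendsto.congr' ((eventually_iteratedFDeriv_mul_ray_eq_sum hU hO hx hu hh hray m).filter_mono (nhdsLT_le_nhdsNE 0)
    |>.mono fun t ht => ht.symm) ?_
  exact tendsto_finsetSum _ fun s _ =>
    ((tendsto_iteratedFDeriv_apply_ray hU hx hu v s.card _).mono_left nhdsWithin_le_nhds).mul (hlim sᶜ)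

/-- **LEIBNIZ FOR ONE-SIDED JUMPS (all orders, every word).**  `u` `C^∞` on an open `U ∋ x`; `h` `C^∞` on an open `O` containing the punctured ray near `x`; for every
`s ⊆ Fin n` the jet `t ↦ D^{|s|}h(x + t v)(m ∘ s↑)` has one-sided limits `Lp s`, `Lm s` at `t = 0`.  Then `t ↦ Dⁿ(u·h)(x + t v)(m)` has both one-sided limits and the jump
`Σ_s D^{|s|}u(x)(m ∘ s↑) · (Lp sᶜ − Lm sᶜ)` (★ `HasOneSidedJump`).  The order-`0` case is ★ `hasOneSidedJump_mul_of_tendsto`. [cite: Shelstad1979, §4 Prop. 4.5 p. 26; Lemma 4.3 p. 25]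
[cite: Bouaziz1994IntegralesOrbitales, §3.2 (I₃) p. 580] [cite: HormanderALPDO1, §1.1 (1.1.9) p. 12] -/
theorem hasOneSidedJump_iteratedFDeriv_mul_ray {U O : Set E} (hU : IsOpen U) (hO : IsOpen O) {x v : E} (hx : x ∈ U) {u h : E → ℂ}
    (hu : ContDiffOn ℝ ∞ u U) (hh : ContDiffOn ℝ ∞ h O) (hray : ∀ᶠ t : ℝ in 𝓝[≠] 0, x + t • v ∈ O) {n : ℕ} (m : Fin n → E)
    {Lp Lm : Finset (Fin n) → ℂ}
    (hlim : ∀ s : Finset (Fin n),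
      Tendsto (fun t : ℝ => iteratedFDeriv ℝ s.card h (x + t • v) (m ∘ ⇑(s.orderEmbOfFin rfl))) (𝓝[>] 0) (𝓝 (Lp s)) ∧
      Tendsto (fun t : ℝ => iteratedFDeriv ℝ s.card h (x + t • v) (m ∘ ⇑(s.orderEmbOfFin rfl))) (𝓝[<] 0) (𝓝 (Lm s))) :
    HasOneSidedJump (fun t : ℝ => iteratedFDeriv ℝ n (fun y => u y * h y) (x + t • v) m)
      (∑ s : Finset (Fin n), iteratedFDeriv ℝ s.card u x (m ∘ ⇑(s.orderEmbOfFin rfl)) * (Lp sᶜ - Lm sᶜ)) :=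
  ⟨_, _, tendsto_iteratedFDeriv_mul_ray_nhdsGT hU hO hx hu hh hray m fun s => (hlim s).1,
    tendsto_iteratedFDeriv_mul_ray_nhdsLT hU hO hx hu hh hray m fun s => (hlim s).2, by
      rw [← Finset.sum_sub_distrib]
      exact Finset.sum_congr rfl fun s _ => (mul_sub _ _ _).symm⟩

/-- **COROLLARY — A SMOOTH FACTOR DOES NOT CREATE JUMPS**: if every jet of `h` along the ray has EQUAL one-sided limits (no jump on any sub-word), the jets of `u · h` have no
jump. [cite: Shelstad1979, §4 property (II) p. 23] [cite: Bouaziz1994IntegralesOrbitales, §3.2 (I₂) p. 579] -/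
theorem hasOneSidedJump_iteratedFDeriv_mul_ray_zero {U O : Set E} (hU : IsOpen U) (hO : IsOpen O) {x v : E} (hx : x ∈ U) {u h : E → ℂ}
    (hu : ContDiffOn ℝ ∞ u U) (hh : ContDiffOn ℝ ∞ h O) (hray : ∀ᶠ t : ℝ in 𝓝[≠] 0, x + t • v ∈ O) {n : ℕ} (m : Fin n → E)
    {L : Finset (Fin n) → ℂ}
    (hlim : ∀ s : Finset (Fin n),
      Tendsto (fun t : ℝ => iteratedFDeriv ℝ s.card h (x + t • v) (m ∘ ⇑(s.orderEmbOfFin rfl))) (𝓝[>] 0) (𝓝 (L s)) ∧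
      Tendsto (fun t : ℝ => iteratedFDeriv ℝ s.card h (x + t • v) (m ∘ ⇑(s.orderEmbOfFin rfl))) (𝓝[<] 0) (𝓝 (L s))) :
    HasOneSidedJump (fun t : ℝ => iteratedFDeriv ℝ n (fun y => u y * h y) (x + t • v) m) 0 := by
  have hJ := hasOneSidedJump_iteratedFDeriv_mul_ray hU hO hx hu hh hray m hlim
  simp only [sub_self, mul_zero, Finset.sum_const_zero] at hJ
  exact hJ

/-! ## ED. 2 — the jump form in `HasOneSidedJump` currency for the rough factor (append-only; ED. 1 statements byte-identical) -/

/-- **LEIBNIZ FOR ONE-SIDED JUMPS, JUMP-DATA FORM**: if for every subset `s ⊆ Fin n` the jet `t ↦ D^{|s|}h(x + t v)(m ∘ s↑)` HAS A ONE-SIDED JUMP `J s` (★ `HasOneSidedJump`,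
both one-sided limits exist), and `u` is `C^∞` near `x`, then `t ↦ Dⁿ(u·h)(x + t v)(m)` has the one-sided jump `Σ_s D^{|s|}u(x)(m ∘ s↑) · J sᶜ`.
(The consumer shape of (I₃-TRANSF) ED. 3: `h` = the κ-weighted partner sum, `J` from ★ `ArchHcJump` on sub-words, `u` = the entire unit.)
[cite: Shelstad1979, §4 Prop. 4.5 p. 26; Lemma 4.3 p. 25] [cite: Bouaziz1994IntegralesOrbitales, §3.2 (I₃) p. 580] -/
theorem hasOneSidedJump_iteratedFDeriv_mul_ray_of_jumps {U O : Set E} (hU : IsOpen U) (hO : IsOpen O) {x v : E} (hx : x ∈ U) {u h : E → ℂ}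
    (hu : ContDiffOn ℝ ∞ u U) (hh : ContDiffOn ℝ ∞ h O) (hray : ∀ᶠ t : ℝ in 𝓝[≠] 0, x + t • v ∈ O) {n : ℕ} (m : Fin n → E)
    {J : Finset (Fin n) → ℂ}
    (hJ : ∀ s : Finset (Fin n), HasOneSidedJump (fun t : ℝ => iteratedFDeriv ℝ s.card h (x + t • v) (m ∘ ⇑(s.orderEmbOfFin rfl))) (J s)) :
    HasOneSidedJump (fun t : ℝ => iteratedFDeriv ℝ n (fun y => u y * h y) (x + t • v) m)
      (∑ s : Finset (Fin n), iteratedFDeriv ℝ s.card u x (m ∘ ⇑(s.orderEmbOfFin rfl)) * J sᶜ) := by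
  choose Lp Lm hLp hLm hLJ using hJ
  have h := hasOneSidedJump_iteratedFDeriv_mul_ray hU hO hx hu hh hray m (Lp := Lp) (Lm := Lm) fun s => ⟨hLp s, hLm s⟩
  refine ⟨_, _, h.choose_spec.choose_spec.1, h.choose_spec.choose_spec.2.1, ?_⟩
  rw [h.choose_spec.choose_spec.2.2]
  exact Finset.sum_congr rfl fun s _ => by rw [hLJ sᶜ]

/-- **JUMP-DATA FORM, ZERO CASE**: no sub-word of `h` jumps ⇒ no jet of `u · h` jumps. [cite: Shelstad1979, §4 property (II) p. 23] -/
theorem hasOneSidedJump_iteratedFDeriv_mul_ray_zero_of_jumps {U O : Set E} (hU : IsOpen U) (hO : IsOpen O) {x v : E} (hx : x ∈ U) {u h : E → ℂ}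
    (hu : ContDiffOn ℝ ∞ u U) (hh : ContDiffOn ℝ ∞ h O) (hray : ∀ᶠ t : ℝ in 𝓝[≠] 0, x + t • v ∈ O) {n : ℕ} (m : Fin n → E)
    (hJ : ∀ s : Finset (Fin n), HasOneSidedJump (fun t : ℝ => iteratedFDeriv ℝ s.card h (x + t • v) (m ∘ ⇑(s.orderEmbOfFin rfl))) 0) :
    HasOneSidedJump (fun t : ℝ => iteratedFDeriv ℝ n (fun y => u y * h y) (x + t • v) m) 0 := by
  have h := hasOneSidedJump_iteratedFDeriv_mul_ray_of_jumps hU hO hx hu hh hray m (J := fun _ => 0) hJ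
  simp only [mul_zero, Finset.sum_const_zero] at h
  exact h

end Literature.NumberTheory.Automorphic.Shelstad1979.StableOrbitalIntegrals
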